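import Literature.Computability.AlgebraicComplexity.RankMethodBarriers
import Mathlib.LinearAlgebra.Multilinear.Basic
import Mathlib.Algebra.Order.Antidiag.Finsupp
import HarnessLib

/-!
# Rank-one tensors as a multilinear map; frames of basic subspaces; a monomial count

Topic `Literature/Computability/AlgebraicComplexity`. Infrastructure for the tensor-rank side of
the lifting barriers of Garg–Makam–Oliveira–Wigderson 2019 (§5: "basic subspaces"
`U₁ ⊗ ⋯ ⊗ U_k ⊆ Ten(m,k)`, Def. 5.3, and the bound `r(U) ≤ ∏_{i ≠ p} dim Uᵢ`, Lemma 5.4), in the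
tree's coordinates (`Ten(m,k) = (Fin k → Fin m) → F`, `rankOneTensor`, `tensorRankD` of
`RankMethodBarriers.lean`):

* `rankOneMultilinear` — `u ↦ u₀ ⊗ ⋯ ⊗ u_{k-1}` as a `MultilinearMap` (so Mathlib's multilinear
  expansions `map_sum`, `map_smul_univ`, `map_update_*` apply to `rankOneTensor`);
* `exists_sum_rankOneTensor_eq`, `exists_sum_rankOneTensor_eq_of_tensorRankD_le`,
  `tensorRankD_smul_le`: every `k`-tensor (`k ≥ 1`) is a sum of rank-one tensors, a tensor of rank
  `≤ a` is a sum of exactly `a` of them, and tensor rank does not grow under scaling — over any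
  commutative semiring (the `Field` versions with an explicit `0 < k` in
  `Literature/Barriers/ValiantsHypothesis/NumericToSymbolicTransfer.lean` are the special case);
* `frameMap frame slot` — for a finite family of "frames" (a rank-one tensor with one free slot
  each) the linear map `w ↦ ∑_b frame_b[slot_b := w_b]`; its range is a subspace all of whose
  elements have tensor rank `≤ #frames` (`tensorRankD_frameMap_le`) — this is how Lemma 5.4 is
  used: `U₁ ⊗ ⋯ ⊗ U_k` is contained in the range of the frame map indexed by tuples of basis vectors
  of the `Uᵢ`, `i ≠ p`;
* `card_finsuppAntidiag_univ_le_pow` — the number of monomials of degree `ν` in `n` variables is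
  at most `n^ν` (the count behind `dim 𝒞_{μ_j} ≤ binom(n+μ_j-1, μ_j) = O(n^{μ_j})`, Lemma 5.13; the
  exact count `binom(n+ν-1, ν)` is Mathlib's `Finset.card_finsuppAntidiag_nat_eq_choose` / the
  tree's `ShiftedPartialsTwoPowers.card_finsuppAntidiag_univ`, only the crude bound is used).

## References

* [GargMakamOliveiraWigderson2019] A. Garg, V. Makam, R. Oliveira, A. Wigderson, *More barriers
  for rank methods, via a "numeric to symbolic" transfer*, FOCS 2019 (arXiv:1904.04299), §5
  (Lemma 5.2, Def. 5.3, Lemma 5.4, Lemma 5.13).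
-/

noncomputable section

open scoped BigOperators

namespace Literature.Computability.AlgebraicComplexity

variable (F : Type*) [CommSemiring F] (k m : ℕ)

/-! ## Rank-one tensors as a multilinear map -/

/-- Pull-back of a vector along the `j`-th coordinate of a multi-index: `x ↦ (i ↦ x (i j))`.
[folklore] -/
def slotEval (j : Fin k) : (Fin m → F) →ₗ[F] ((Fin k → Fin m) → F) :=
  LinearMap.pi fun i => LinearMap.proj (i j)

/-- Unfolding lemma. [folklore] -/
@[simp] theorem slotEval_apply (j : Fin k) (x : Fin m → F) (i : Fin k → Fin m) :
    slotEval F k m j x i = x (i j) := rfl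

/-- The multilinear map `(u₀, …, u_{k-1}) ↦ u₀ ⊗ ⋯ ⊗ u_{k-1} ∈ Ten(m,k)` (GMOW 2019, §5.2: the
parametrisation `ψ` of the rank-one tensors is set-multilinear). [cite: GargMakamOliveiraWigderson2019, §5.2] -/
def rankOneMultilinear : MultilinearMap F (fun _ : Fin k => Fin m → F) ((Fin k → Fin m) → F) :=
  (MultilinearMap.mkPiAlgebra F (Fin k) ((Fin k → Fin m) → F)).compLinearMap
    fun j => slotEval F k m j

variable {F k m}

/-- `rankOneMultilinear u = u₀ ⊗ ⋯ ⊗ u_{k-1}`. [cite: GargMakamOliveiraWigderson2019, §5.2] -/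
@[simp] theorem rankOneMultilinear_apply (u : Fin k → Fin m → F) :
    rankOneMultilinear F k m u = rankOneTensor u := by
  funext i
  simp only [rankOneMultilinear, MultilinearMap.compLinearMap_apply,
    MultilinearMap.mkPiAlgebra_apply, Finset.prod_apply, slotEval_apply, rankOneTensor_apply]

/-- A rank-one tensor with a zero factor vanishes. [folklore] -/
theorem rankOneTensor_update_zero (u : Fin k → Fin m → F) (j : Fin k) :
    rankOneTensor (Function.update u j 0) = 0 := by
  classical
  rw [← rankOneMultilinear_apply]
  exact MultilinearMap.map_update_zero _ u j

/-- Scaling one factor scales the rank-one tensor. [folklore] -/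
theorem rankOneTensor_update_smul (u : Fin k → Fin m → F) (j : Fin k) (c : F) (x : Fin m → F) :
    rankOneTensor (Function.update u j (c • x)) = c • rankOneTensor (Function.update u j x) := by
  classical
  rw [← rankOneMultilinear_apply, ← rankOneMultilinear_apply]
  exact MultilinearMap.map_update_smul _ u j c x

/-- `c • (u₀ ⊗ ⋯) = (c u₀) ⊗ ⋯` (`k ≥ 1`). [folklore] -/
theorem smul_rankOneTensor [NeZero k] (c : F) (u : Fin k → Fin m → F) :
    c • rankOneTensor u = rankOneTensor (Function.update u 0 (c • u 0)) := by
  rw [rankOneTensor_update_smul, Function.update_eq_self]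

/-! ## Every tensor is a sum of rank-one tensors; scaling; sub-additivity -/

/-- The coordinate tensor `e_{i}` is rank one: `⊗_j e_{i_j}`. [folklore] -/
theorem rankOneTensor_single (i : Fin k → Fin m) :
    rankOneTensor (fun j => (Pi.single (i j) (1 : F) : Fin m → F)) = Pi.single i 1 := by
  classical
  funext i'
  rw [rankOneTensor_apply]
  by_cases h : i' = i
  · subst h
    simp
  · rw [Pi.single_eq_of_ne h]
    obtain ⟨j, hj⟩ := Function.ne_iff.1 h
    exact Finset.prod_eq_zero (Finset.mem_univ j) (by rw [Pi.single_eq_of_ne hj])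

/-- Every `k`-tensor (`k ≥ 1`) is a sum of rank-one tensors (the rank-one tensors span
`Ten(m,k)`, GMOW 2019, Def. 1.2 with Def. 1.1). [cite: GargMakamOliveiraWigderson2019, Def. 1.2] -/
theorem exists_sum_rankOneTensor_eq [NeZero k] (T : (Fin k → Fin m) → F) :
    ∃ (s : ℕ) (u : Fin s → Fin k → Fin m → F), ∑ t, rankOneTensor (u t) = T := by
  classical
  -- `T = ∑_i T i • e_i`, each term rank one
  set N := Fintype.card (Fin k → Fin m)
  set e := (Fintype.equivFin (Fin k → Fin m)).symm
  refine ⟨N, fun t => Function.update (fun j => (Pi.single (e t j) (1 : F) : Fin m → F)) 0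
    (T (e t) • Pi.single (e t 0) 1), ?_⟩
  have : ∀ t, rankOneTensor (Function.update (fun j => (Pi.single (e t j) (1 : F) : Fin m → F)) 0
      (T (e t) • Pi.single (e t 0) 1)) = T (e t) • Pi.single (e t) 1 := by
    intro t
    rw [rankOneTensor_update_smul, Function.update_eq_self, rankOneTensor_single]
  simp_rw [this]
  rw [Equiv.sum_comp e (fun i => T i • (Pi.single i (1 : F) : (Fin k → Fin m) → F))]
  funext i
  simp [Finset.sum_apply, Pi.single_apply]

/-- A tensor of rank `≤ a` is a sum of exactly `a` rank-one tensors (`k ≥ 1`; pad with zeros).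
[folklore] -/
theorem exists_sum_rankOneTensor_eq_of_tensorRankD_le [NeZero k] {T : (Fin k → Fin m) → F} {a : ℕ}
    (h : tensorRankD T ≤ a) : ∃ u : Fin a → Fin k → Fin m → F, ∑ t, rankOneTensor (u t) = T := by
  classical
  obtain ⟨s, u, hu⟩ := exists_sum_rankOneTensor_eq T
  have hspec : ∃ g : Fin (tensorRankD T) → (Fin k → Fin m) → F,
      (∀ i, g i ∈ rankOneTensors F m k) ∧ ∑ i, g i = T :=
    sComplexity_spec (S := rankOneTensors F m k) (f := T)
      ⟨s, fun t => rankOneTensor (u t), fun t => rankOneTensor_mem _, hu⟩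
  obtain ⟨g, hg, hgT⟩ := hspec
  choose w hw using hg
  obtain ⟨s', rfl⟩ := Nat.exists_eq_add_of_le h
  refine ⟨Fin.append w fun _ _ => 0, ?_⟩
  rw [Fin.sum_univ_add]
  have h1 : ∀ t : Fin (tensorRankD T),
      rankOneTensor (Fin.append w (fun _ _ => (0 : Fin m → F)) (Fin.castAdd s' t)) = g t := by
    intro t
    rw [Fin.append_left]
    exact hw t
  have h0 : ∀ t : Fin s',
      rankOneTensor (Fin.append w (fun _ _ => (0 : Fin m → F)) (Fin.natAdd (tensorRankD T) t)) =
        0 := by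
    intro t
    rw [Fin.append_right]
    funext i
    rw [rankOneTensor_apply]
    exact Finset.prod_eq_zero (Finset.mem_univ (0 : Fin k)) rfl
  rw [Finset.sum_congr rfl fun t _ => h0 t, Finset.sum_const_zero, add_zero]
  exact (Finset.sum_congr rfl fun t _ => h1 t).trans hgT

/-- Tensor rank does not increase under scaling (`k ≥ 1`). [folklore] -/
theorem tensorRankD_smul_le [NeZero k] (c : F) (T : (Fin k → Fin m) → F) :
    tensorRankD (c • T) ≤ tensorRankD T := by
  obtain ⟨u, hu⟩ := exists_sum_rankOneTensor_eq_of_tensorRankD_le (le_refl (tensorRankD T))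
  refine tensorRankD_le_of_eq_sum (fun t => Function.update (u t) 0 (c • u t 0)) ?_
  simp_rw [← smul_rankOneTensor, ← Finset.smul_sum, hu]

/-- `trk 0 = 0`. [folklore] -/
@[simp] theorem tensorRankD_zero : tensorRankD (0 : (Fin k → Fin m) → F) = 0 :=
  sComplexity_zero _

/-! ## Frame maps: subspaces of bounded tensor rank (GMOW 2019, Lemmas 5.2 and 5.4) -/

section Frame

variable {B : Type*} [Fintype B] (frame : B → Fin k → Fin m → F) (slot : B → Fin k)

/-- The **frame map** of a finite family of frames: `w ↦ ∑_b frame_b[slot_b := w_b]`, the sum of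
the rank-one tensors obtained by filling the free slot `slot b` of each frame with `w b`. Its
range is a linear subspace of tensors of rank `≤ #B` — the mechanism of GMOW 2019, Lemma 5.2
(`φ(S) ⊆ ∑ U_I` implies `φ(V) ⊆ ∑ U_I`, a subspace, and `μ_φ(V) ≤ ∑ r(U_I)`; cf. §3.1: sums of such
tensors are "also of the same form") and Lemma 5.4 (`r(U₁ ⊗ ⋯ ⊗ U_k) ≤ ∏_{i ≠ p} dim Uᵢ`:
frames = tuples of basis vectors of the `Uᵢ`, `i ≠ p`, free slot `p`).
[cite: GargMakamOliveiraWigderson2019, Lemma 5.4] -/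
def frameMap : (B → Fin m → F) →ₗ[F] ((Fin k → Fin m) → F) := by
  classical
  exact ∑ b : B, ((rankOneMultilinear F k m).toLinearMap (frame b) (slot b)).comp (LinearMap.proj b)

/-- Unfolding lemma. [cite: GargMakamOliveiraWigderson2019, Lemma 5.4] -/
theorem frameMap_apply (w : B → Fin m → F) :
    frameMap frame slot w = ∑ b, rankOneTensor (Function.update (frame b) (slot b) (w b)) := by
  classical
  unfold frameMap
  rw [LinearMap.sum_apply]
  refine Finset.sum_congr rfl fun b _ => ?_
  rw [LinearMap.comp_apply, LinearMap.proj_apply, MultilinearMap.toLinearMap_apply,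
    rankOneMultilinear_apply]

/-- **GMOW 2019, Lemma 5.4 (mechanism).** Every tensor in the range of a frame map has tensor rank
at most the number of frames. [cite: GargMakamOliveiraWigderson2019, Lemma 5.4] -/
theorem tensorRankD_frameMap_le (w : B → Fin m → F) :
    tensorRankD (frameMap frame slot w) ≤ Fintype.card B := by
  classical
  rw [frameMap_apply]
  set e := (Fintype.equivFin B).symm
  refine tensorRankD_le_of_eq_sum (fun t => Function.update (frame (e t)) (slot (e t)) (w (e t))) ?_
  exact Equiv.sum_comp e (fun b => rankOneTensor (Function.update (frame b) (slot b) (w b)))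

/-- Each filled frame lies in the range of the frame map. [cite: GargMakamOliveiraWigderson2019, Lemma 5.4] -/
theorem rankOneTensor_update_mem_range_frameMap (b : B) (x : Fin m → F) :
    rankOneTensor (Function.update (frame b) (slot b) x) ∈ LinearMap.range (frameMap frame slot) := by
  classical
  refine ⟨Pi.single b x, ?_⟩
  rw [frameMap_apply, Fintype.sum_eq_single b]
  · rw [Pi.single_eq_same]
  · intro b' hb'
    rw [Pi.single_eq_of_ne hb', rankOneTensor_update_zero]

end Frame

/-! ## Counting monomials -/

/-- Membership in `univ.finsuppAntidiag ν` is `degree = ν`. [folklore] -/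
theorem mem_finsuppAntidiag_univ_iff {n ν : ℕ} (e : Fin n →₀ ℕ) :
    e ∈ (Finset.univ : Finset (Fin n)).finsuppAntidiag ν ↔ e.degree = ν := by
  classical
  rw [Finset.mem_finsuppAntidiag, Finsupp.degree_eq_sum]
  simp

/-- The number of exponent vectors `e : Fin n →₀ ℕ` of degree `ν` (monomials of degree `ν` in `n`
variables) is at most `n^ν`. The exact count `binom(n+ν-1, ν)` is Mathlib's
`Finset.card_finsuppAntidiag_nat_eq_choose` (tree: `ShiftedPartialsTwoPowers.card_finsuppAntidiag_univ`);
only this crude bound is needed downstream. [folklore] -/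
theorem card_finsuppAntidiag_univ_le_pow (n ν : ℕ) :
    ((Finset.univ : Finset (Fin n)).finsuppAntidiag ν).card ≤ n ^ ν := by
  classical
  induction ν with
  | zero => simp
  | succ ν ih =>
    -- `(e, i) ↦ e + δ_i` maps `A_ν × [n]` onto `A_{ν+1}`
    set A : ℕ → Finset (Fin n →₀ ℕ) := fun ν => (Finset.univ : Finset (Fin n)).finsuppAntidiag ν
      with hA
    have hsurj : A (ν + 1) ⊆ (A ν ×ˢ (Finset.univ : Finset (Fin n))).image
        fun p => p.1 + Finsupp.single p.2 1 := by
      intro e he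
      have hdeg : e.degree = ν + 1 := (mem_finsuppAntidiag_univ_iff e).1 he
      have hex : ∃ i, e i ≠ 0 := by
        by_contra hall
        push Not at hall
        have : e = 0 := Finsupp.ext hall
        rw [this, map_zero] at hdeg
        omega
      obtain ⟨i, hi⟩ := hex
      set e' : Fin n →₀ ℕ := e.update i (e i - 1) with he'
      have hee' : e' + Finsupp.single i 1 = e := by
        ext j
        rw [Finsupp.add_apply, he', Finsupp.update_apply, Finsupp.single_apply]
        by_cases hj : j = i
        · subst hj
          rw [if_pos rfl, if_pos rfl]
          omega
        · rw [if_neg hj, if_neg (Ne.symm hj), add_zero]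
      refine Finset.mem_image.2 ⟨(e', i), ?_, hee'⟩
      rw [Finset.mem_product]
      refine ⟨(mem_finsuppAntidiag_univ_iff e').2 ?_, Finset.mem_univ _⟩
      have := congrArg Finsupp.degree hee'
      rw [map_add, Finsupp.degree_single, hdeg] at this
      omega
    calc (A (ν + 1)).card
        ≤ ((A ν ×ˢ (Finset.univ : Finset (Fin n))).image
            fun p => p.1 + Finsupp.single p.2 1).card := Finset.card_le_card hsurj
      _ ≤ (A ν ×ˢ (Finset.univ : Finset (Fin n))).card := Finset.card_image_le
      _ = (A ν).card * n := by rw [Finset.card_product, Finset.card_univ, Fintype.card_fin]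
      _ ≤ n ^ ν * n := Nat.mul_le_mul_right n ih
      _ = n ^ (ν + 1) := (pow_succ n ν).symm

end Literature.Computability.AlgebraicComplexity
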